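import Summits.AtomisticToContinuum.Crystallization.Theses.GappedShellCensus

/-!
# Crux attack on `GappedShellCensus.RadialDefectsVanish` (stmt-AtomisticToContinuum-15930)

Kernel-checked findings of the refuter one-shot:

* `radialDefectsVanish_iff` — the route decl is definitionally the informal statement
  (gapped-twelve predicate `IsGappedTwelveAt` factored out);
* `radialDefectsVanish_false_without_GS` — 3c/mutation check: the ground-state hypothesis is
  load-bearing; the counting conclusion is NOT a tautology (the dilated line `i ↦ 2i·e₀` has no
  particle within `1.02·a ≤ 1.02` of any other, so every site is bad and `#bad = N > N/2`).
-/

open Literature.MathematicalPhysics.StatisticalMechanics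

namespace Summit.AtomisticToContinuum.Crystallization.Theorems.RadialDefectsVanish.Negative

open Summit.AtomisticToContinuum.Crystallization.Theses.GappedShellCensus

/-- Site `i` of `x N` is gapped-twelve at scale `a` (tolerance `1/50`, Hales gap `63/50`):
the inline clause of `RadialDefectsVanish`. -/
def IsGappedTwelveAt (x : (N : ℕ) → (Fin N → EuclideanSpace ℝ (Fin 3))) (a : ℝ) (N : ℕ)
    (i : Fin N) : Prop :=
  (Finset.univ.filter fun j : Fin N => j ≠ i ∧ dist (x N i) (x N j) ≤ a * (1 + 1 / 50)).card = 12 ∧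
    ∀ j : Fin N, j ≠ i → a * (1 - 1 / 50) ≤ dist (x N i) (x N j) ∧
      (dist (x N i) (x N j) ≤ a * (1 + 1 / 50) ∨ a * (63 / 50) ≤ dist (x N i) (x N j))

/-- The conclusion of `RadialDefectsVanish` for one sequence `x`. -/
def RadialConclusion (x : (N : ℕ) → (Fin N → EuclideanSpace ℝ (Fin 3))) : Prop :=
  ∃ a : ℝ, 47 / 50 ≤ a ∧ a ≤ 1 ∧ ∀ θ : ℝ, 0 < θ → ∃ᶠ N in Filter.atTop,
    (Nat.card {i : Fin N // ¬ IsGappedTwelveAt x a N i} : ℝ) ≤ θ * N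

/-- The route decl, refactored (definitional). -/
theorem radialDefectsVanish_iff :
    RadialDefectsVanish ↔ ∀ x : (N : ℕ) → (Fin N → EuclideanSpace ℝ (Fin 3)),
      (∀ N, IsGroundState lennardJones (x N)) → RadialConclusion x :=
  Iff.rfl

/-- `RadialDefectsVanish` with the ground-state hypothesis DROPPED. -/
def RadialDefectsVanishWithoutGS : Prop :=
  ∀ x : (N : ℕ) → (Fin N → EuclideanSpace ℝ (Fin 3)), RadialConclusion x

/-- The dilated line `x N i = (2 i) • e₀`. -/
noncomputable def dilatedLine : (N : ℕ) → (Fin N → EuclideanSpace ℝ (Fin 3)) :=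
  fun _ i => ((2 : ℝ) * (i : ℕ)) • EuclideanSpace.single (0 : Fin 3) (1 : ℝ)

/-- Distances on the dilated line: `|x i - x j| = 2|i - j|`. -/
theorem dist_dilatedLine (N : ℕ) (i j : Fin N) :
    dist (dilatedLine N i) (dilatedLine N j) = 2 * |((i : ℕ) : ℝ) - ((j : ℕ) : ℝ)| := by
  simp only [dilatedLine, dist_eq_norm, ← sub_smul, norm_smul, EuclideanSpace.single, PiLp.norm_single, norm_one,
    mul_one, Real.norm_eq_abs, ← mul_sub, abs_mul, abs_two]

/-- Distinct sites of the dilated line are at distance `≥ 2`. -/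
theorem two_le_dist_dilatedLine (N : ℕ) {i j : Fin N} (h : j ≠ i) :
    2 ≤ dist (dilatedLine N i) (dilatedLine N j) := by
  rw [dist_dilatedLine]
  have hne : (i : ℕ) ≠ (j : ℕ) := fun h' => h (Fin.ext h').symm
  have h1 : (1 : ℝ) ≤ |((i : ℕ) : ℝ) - ((j : ℕ) : ℝ)| := by
    rcases lt_or_gt_of_ne hne with hlt | hgt
    · have : ((i : ℕ) : ℝ) + 1 ≤ ((j : ℕ) : ℝ) := by exact_mod_cast hlt
      rw [abs_sub_comm, abs_of_pos (by linarith)]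
      linarith
    · have : ((j : ℕ) : ℝ) + 1 ≤ ((i : ℕ) : ℝ) := by exact_mod_cast hgt
      rw [abs_of_pos (by linarith)]
      linarith
  linarith

/-- On the dilated line no site is gapped-twelve at any scale `a ≤ 1` (the bond shell is empty). -/
theorem not_isGappedTwelveAt_dilatedLine {a : ℝ} (ha : a ≤ 1) (N : ℕ) (i : Fin N) :
    ¬ IsGappedTwelveAt dilatedLine a N i := by
  rintro ⟨hcard, -⟩
  have hempty : (Finset.univ.filter fun j : Fin N =>
      j ≠ i ∧ dist (dilatedLine N i) (dilatedLine N j) ≤ a * (1 + 1 / 50)) = ∅ := by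
    refine Finset.filter_eq_empty_iff.mpr ?_
    rintro j - ⟨hji, hd⟩
    have h2 := two_le_dist_dilatedLine N hji
    nlinarith
  rw [hempty, Finset.card_empty] at hcard
  exact absurd hcard (by norm_num)

/-- **Mutation check (3c):** without the ground-state hypothesis the conclusion of
`RadialDefectsVanish` fails — witness the dilated line, on which every one of the `N` sites is
bad, so `#bad = N ≤ θN` fails for `θ = 1/2`, `N ≥ 1`. Any proof must use `IsGroundState`. -/
theorem radialDefectsVanish_false_without_GS : ¬ RadialDefectsVanishWithoutGS := by
  intro h
  obtain ⟨a, -, ha1, hθ⟩ := h dilatedLine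
  have hhalf := hθ (1 / 2) (by norm_num)
  rw [Filter.frequently_atTop] at hhalf
  obtain ⟨N, hN1, hN⟩ := hhalf 1
  have hcardN : Nat.card {i : Fin N // ¬ IsGappedTwelveAt dilatedLine a N i} = N := by
    rw [Nat.card_congr (Equiv.subtypeUnivEquiv fun i => not_isGappedTwelveAt_dilatedLine ha1 N i),
      Nat.card_eq_fintype_card, Fintype.card_fin]
  rw [hcardN] at hN
  have hN1' : (1 : ℝ) ≤ N := by exact_mod_cast hN1
  linarith

end Summit.AtomisticToContinuum.Crystallization.Theorems.RadialDefectsVanish.Negative
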